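import Summits.CriticalPhenomena.PercolationContinuityZ3.Theorems.PercNearOneGluingNoHeavyLowerTailSahiGridPatternDiagCertBlockAndTheta
import Summits.CriticalPhenomena.PercolationContinuityZ3.Theorems.PercNearOneGluingNoHeavyLowerTailSahiGridPatternThreeStarPrelim
import Summits.CriticalPhenomena.PercolationContinuityZ3.Theorems.PercNearOneGluingNoHeavyLowerTailSahiGridPatternLiteralTwoAbsorb

/-!
# `NoHeavyLowerTail` (crux stmt-CriticalPhenomena-4575), Sahi programme P1: **TWO-AXIS SECTION FORMULA FOR THE TWO-PAYER OR STAR** —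
# `Θ_U(B×C)` for `U = (x∧y) ∨ V ⊆ [3]^{2+k}` as an explicit sum over the 36 ordered totally distinct pairs of outer cells

Support file (Sahi cell, seat `prim-sahi-p1`, generation 36; `--supports stmt-CriticalPhenomena-4575`).  Pure proofs, no definitions, no `sorry`, standard axioms.
Vocabulary of `…SahiGridPattern{,CellForm,SliceForm,PairCert,ThreeStarPrelim,DiagCertBlockAndTheta}` (`Pd`, `glue`, `sect`, `ind`, `TotDist`, `thirdPt`, `thetaVal`,
`sum_glue`, `sum_pd1`, `pd1_facts`, `ite_totDist_glue`, `thirdPt_glue`, `theta_pairs_eq_sum4`).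

THE MATHEMATICS (seat memo FROM-prim-sahi-p1-gen36 §2.2, §6(2b)).  Points of `[3]^{2+k} = [3]^{1+(1+k)}` are written `glue ξ (glue η q)` with the two outer
coordinates `ξ, η ∈ [3]^1` and the inner point `q ∈ [3]^k`; the two-payer OR star is `U = {x ≥ 1 ∧ y ≥ 1} ∨ V`
(`glue ξ (glue η q) ∈ U ↔ (1 ≤ ξ 0 ∧ 1 ≤ η 0) ∨ q ∈ V`).  **THEOREM (`theta_twoPayer_sections`):** for ALL finsets `B, C ⊆ [3]^{2+k}`,
`Σ_{x∈B, y∈C} Θ_U(x,y) = Σ_{q δ̸ r} Σ_{(a,a′) outer td} 1_B(a,q)·1_C(a′,r)·(U_a(q) + U_{a′}(r) − U_{a″}(q̄r))` with the 36 ordered totally distinct outer pairs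
`(a,a′)`, `a″` the third cell of their Latin line, `U_a ≡ 1` on the four T-cells and `U_a = 1_V` on the five others — the bookkeeping that feeds the six line
identities (`…LiteralOrIdentity`, `…LiteralTwoOrIdentity`).  Also: `thetaVal_glue2` (the kernel at doubly glued points) and `ind_twoPayer_glue` (membership).
Nothing here asserts `PatternPos d` for `d ≥ 4` or condition (N) for any block. [this work]
-/

namespace Summit.CriticalPhenomena.PercolationContinuityZ3.Theorems.SahiGridPattern

open Finset SahiGrid3
open scoped BigOperators

variable {k : ℕ}

/-- `Θ_A` at doubly glued points: the total-distinctness indicator factorises over the three blocks and the third point is glued from the third points. [this work] -/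
theorem thetaVal_glue2 (A : Finset (Pd (1 + (1 + k)))) (ξ ξ' η η' : Pd 1) (q r : Pd k) :
    thetaVal A (glue ξ (glue η q)) (glue ξ' (glue η' r))
      = (if TotDist ξ ξ' = true then (1:ℤ) else 0) * ((if TotDist η η' = true then (1:ℤ) else 0) * (if TotDist q r = true then (1:ℤ) else 0))
        * (ind A (glue ξ (glue η q)) + ind A (glue ξ' (glue η' r)) - ind A (glue (thirdPt ξ ξ') (glue (thirdPt η η') (thirdPt q r)))) := by
  rw [thetaVal_eq_ite_mul, ite_totDist_glue, ite_totDist_glue, thirdPt_glue, thirdPt_glue]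

/-- Membership in the two-payer OR star at a doubly glued point. [this work] -/
theorem ind_twoPayer_glue {V : Finset (Pd k)} {U : Finset (Pd (1 + (1 + k)))}
    (hU : ∀ (ξ η : Pd 1) (q : Pd k), glue ξ (glue η q) ∈ U ↔ ((1 ≤ ξ 0 ∧ 1 ≤ η 0) ∨ q ∈ V)) (ξ η : Pd 1) (q : Pd k) :
    ind U (glue ξ (glue η q)) = if (1 ≤ ξ 0 ∧ 1 ≤ η 0) then 1 else ind V q := by
  unfold ind
  simp only [hU]
  by_cases h : (1 ≤ ξ 0 ∧ 1 ≤ η 0)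
  · simp [h]
  · by_cases hq : q ∈ V <;> simp [h, hq]

/-- The nine values of `1_U` on the outer cells (`T`-cells `↦ 1`, the others `↦ 1_V`). [this work] -/
theorem ind_twoPayer_vals {V : Finset (Pd k)} {U : Finset (Pd (1 + (1 + k)))}
    (hU : ∀ (ξ η : Pd 1) (q : Pd k), glue ξ (glue η q) ∈ U ↔ ((1 ≤ ξ 0 ∧ 1 ≤ η 0) ∨ q ∈ V)) (p : Pd k) :
    ind U (glue (fun _ => 0) (glue (fun _ => 0) p)) = ind V p ∧ ind U (glue (fun _ => 0) (glue (fun _ => 1) p)) = ind V p ∧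
    ind U (glue (fun _ => 0) (glue (fun _ => 2) p)) = ind V p ∧ ind U (glue (fun _ => 1) (glue (fun _ => 0) p)) = ind V p ∧
    ind U (glue (fun _ => 1) (glue (fun _ => 1) p)) = 1 ∧ ind U (glue (fun _ => 1) (glue (fun _ => 2) p)) = 1 ∧
    ind U (glue (fun _ => 2) (glue (fun _ => 0) p)) = ind V p ∧ ind U (glue (fun _ => 2) (glue (fun _ => 1) p)) = 1 ∧
    ind U (glue (fun _ => 2) (glue (fun _ => 2) p)) = 1 := by
  have f11 : (1:Fin 3) ≤ 1 := le_rfl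
  have f12 : (1:Fin 3) ≤ 2 := by decide
  have f10 : ¬ (1:Fin 3) ≤ 0 := by decide
  simp only [ind_twoPayer_glue hU, f11, f12, f10, and_true, and_false, if_true, if_false, and_self]

/-- **Two-axis section formula for `Θ_U(B×C)`, `U` the two-payer OR star** (all finsets `B, C`; the 36 ordered totally distinct outer pairs written out). [this work] -/
theorem theta_twoPayer_sections {V : Finset (Pd k)} {U : Finset (Pd (1 + (1 + k)))}
    (hU : ∀ (ξ η : Pd 1) (q : Pd k), glue ξ (glue η q) ∈ U ↔ ((1 ≤ ξ 0 ∧ 1 ≤ η 0) ∨ q ∈ V)) (B C : Finset (Pd (1 + (1 + k)))) :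
    (∑ x ∈ B, ∑ y ∈ C, thetaVal U x y) = ∑ q : Pd k, ∑ r : Pd k, (if TotDist q r = true then (1:ℤ) else 0) *
        ( ind B (glue (fun _ => 0) (glue (fun _ => 0) q)) * ind C (glue (fun _ => 1) (glue (fun _ => 1) r)) * (ind V q + 1 - 1)
          + ind B (glue (fun _ => 0) (glue (fun _ => 0) q)) * ind C (glue (fun _ => 1) (glue (fun _ => 2) r)) * (ind V q + 1 - 1)
          + ind B (glue (fun _ => 0) (glue (fun _ => 0) q)) * ind C (glue (fun _ => 2) (glue (fun _ => 1) r)) * (ind V q + 1 - 1)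
          + ind B (glue (fun _ => 0) (glue (fun _ => 0) q)) * ind C (glue (fun _ => 2) (glue (fun _ => 2) r)) * (ind V q + 1 - 1)
          + ind B (glue (fun _ => 0) (glue (fun _ => 1) q)) * ind C (glue (fun _ => 1) (glue (fun _ => 0) r)) * (ind V q + ind V r - 1)
          + ind B (glue (fun _ => 0) (glue (fun _ => 1) q)) * ind C (glue (fun _ => 1) (glue (fun _ => 2) r)) * (ind V q + 1 - ind V (thirdPt q r))
          + ind B (glue (fun _ => 0) (glue (fun _ => 1) q)) * ind C (glue (fun _ => 2) (glue (fun _ => 0) r)) * (ind V q + ind V r - 1)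
          + ind B (glue (fun _ => 0) (glue (fun _ => 1) q)) * ind C (glue (fun _ => 2) (glue (fun _ => 2) r)) * (ind V q + 1 - ind V (thirdPt q r))
          + ind B (glue (fun _ => 0) (glue (fun _ => 2) q)) * ind C (glue (fun _ => 1) (glue (fun _ => 0) r)) * (ind V q + ind V r - 1)
          + ind B (glue (fun _ => 0) (glue (fun _ => 2) q)) * ind C (glue (fun _ => 1) (glue (fun _ => 1) r)) * (ind V q + 1 - ind V (thirdPt q r))
          + ind B (glue (fun _ => 0) (glue (fun _ => 2) q)) * ind C (glue (fun _ => 2) (glue (fun _ => 0) r)) * (ind V q + ind V r - 1)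
          + ind B (glue (fun _ => 0) (glue (fun _ => 2) q)) * ind C (glue (fun _ => 2) (glue (fun _ => 1) r)) * (ind V q + 1 - ind V (thirdPt q r))
          + ind B (glue (fun _ => 1) (glue (fun _ => 0) q)) * ind C (glue (fun _ => 0) (glue (fun _ => 1) r)) * (ind V q + ind V r - 1)
          + ind B (glue (fun _ => 1) (glue (fun _ => 0) q)) * ind C (glue (fun _ => 0) (glue (fun _ => 2) r)) * (ind V q + ind V r - 1)
          + ind B (glue (fun _ => 1) (glue (fun _ => 0) q)) * ind C (glue (fun _ => 2) (glue (fun _ => 1) r)) * (ind V q + 1 - ind V (thirdPt q r))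
          + ind B (glue (fun _ => 1) (glue (fun _ => 0) q)) * ind C (glue (fun _ => 2) (glue (fun _ => 2) r)) * (ind V q + 1 - ind V (thirdPt q r))
          + ind B (glue (fun _ => 1) (glue (fun _ => 1) q)) * ind C (glue (fun _ => 0) (glue (fun _ => 0) r)) * (1 + ind V r - 1)
          + ind B (glue (fun _ => 1) (glue (fun _ => 1) q)) * ind C (glue (fun _ => 0) (glue (fun _ => 2) r)) * (1 + ind V r - ind V (thirdPt q r))
          + ind B (glue (fun _ => 1) (glue (fun _ => 1) q)) * ind C (glue (fun _ => 2) (glue (fun _ => 0) r)) * (1 + ind V r - ind V (thirdPt q r))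
          + ind B (glue (fun _ => 1) (glue (fun _ => 1) q)) * ind C (glue (fun _ => 2) (glue (fun _ => 2) r)) * (1 + 1 - ind V (thirdPt q r))
          + ind B (glue (fun _ => 1) (glue (fun _ => 2) q)) * ind C (glue (fun _ => 0) (glue (fun _ => 0) r)) * (1 + ind V r - 1)
          + ind B (glue (fun _ => 1) (glue (fun _ => 2) q)) * ind C (glue (fun _ => 0) (glue (fun _ => 1) r)) * (1 + ind V r - ind V (thirdPt q r))
          + ind B (glue (fun _ => 1) (glue (fun _ => 2) q)) * ind C (glue (fun _ => 2) (glue (fun _ => 0) r)) * (1 + ind V r - ind V (thirdPt q r))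
          + ind B (glue (fun _ => 1) (glue (fun _ => 2) q)) * ind C (glue (fun _ => 2) (glue (fun _ => 1) r)) * (1 + 1 - ind V (thirdPt q r))
          + ind B (glue (fun _ => 2) (glue (fun _ => 0) q)) * ind C (glue (fun _ => 0) (glue (fun _ => 1) r)) * (ind V q + ind V r - 1)
          + ind B (glue (fun _ => 2) (glue (fun _ => 0) q)) * ind C (glue (fun _ => 0) (glue (fun _ => 2) r)) * (ind V q + ind V r - 1)
          + ind B (glue (fun _ => 2) (glue (fun _ => 0) q)) * ind C (glue (fun _ => 1) (glue (fun _ => 1) r)) * (ind V q + 1 - ind V (thirdPt q r))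
          + ind B (glue (fun _ => 2) (glue (fun _ => 0) q)) * ind C (glue (fun _ => 1) (glue (fun _ => 2) r)) * (ind V q + 1 - ind V (thirdPt q r))
          + ind B (glue (fun _ => 2) (glue (fun _ => 1) q)) * ind C (glue (fun _ => 0) (glue (fun _ => 0) r)) * (1 + ind V r - 1)
          + ind B (glue (fun _ => 2) (glue (fun _ => 1) q)) * ind C (glue (fun _ => 0) (glue (fun _ => 2) r)) * (1 + ind V r - ind V (thirdPt q r))
          + ind B (glue (fun _ => 2) (glue (fun _ => 1) q)) * ind C (glue (fun _ => 1) (glue (fun _ => 0) r)) * (1 + ind V r - ind V (thirdPt q r))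
          + ind B (glue (fun _ => 2) (glue (fun _ => 1) q)) * ind C (glue (fun _ => 1) (glue (fun _ => 2) r)) * (1 + 1 - ind V (thirdPt q r))
          + ind B (glue (fun _ => 2) (glue (fun _ => 2) q)) * ind C (glue (fun _ => 0) (glue (fun _ => 0) r)) * (1 + ind V r - 1)
          + ind B (glue (fun _ => 2) (glue (fun _ => 2) q)) * ind C (glue (fun _ => 0) (glue (fun _ => 1) r)) * (1 + ind V r - ind V (thirdPt q r))
          + ind B (glue (fun _ => 2) (glue (fun _ => 2) q)) * ind C (glue (fun _ => 1) (glue (fun _ => 0) r)) * (1 + ind V r - ind V (thirdPt q r))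
          + ind B (glue (fun _ => 2) (glue (fun _ => 2) q)) * ind C (glue (fun _ => 1) (glue (fun _ => 1) r)) * (1 + 1 - ind V (thirdPt q r)) ) := by
  obtain ⟨h00, h11, h22, h01, h02, h10, h12, h20, h21, t01, t02, t10, t12, t20, t21⟩ := pd1_facts
  obtain ⟨u00, u01, u02, u10, u11, u12, u20, u21, u22⟩ := And.intro (fun p => (ind_twoPayer_vals hU p).1) (And.intro (fun p => (ind_twoPayer_vals hU p).2.1)
    (And.intro (fun p => (ind_twoPayer_vals hU p).2.2.1) (And.intro (fun p => (ind_twoPayer_vals hU p).2.2.2.1) (And.intro (fun p => (ind_twoPayer_vals hU p).2.2.2.2.1)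
    (And.intro (fun p => (ind_twoPayer_vals hU p).2.2.2.2.2.1) (And.intro (fun p => (ind_twoPayer_vals hU p).2.2.2.2.2.2.1)
    (And.intro (fun p => (ind_twoPayer_vals hU p).2.2.2.2.2.2.2.1) (fun p => (ind_twoPayer_vals hU p).2.2.2.2.2.2.2.2))))))))
  rw [theta_pairs_eq_sum4 (A := U) (n := 1) (k := 1 + k) B C]
  simp only [sum_glue (n := 1) (k := k), sum_pd1, Finset.sum_add_distrib, thetaVal_glue2,
    h00, h11, h22, h01, h02, h10, h12, h20, h21, t01, t02, t10, t12, t20, t21,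
    u00, u01, u02, u10, u11, u12, u20, u21, u22,
    Bool.false_eq_true, if_false, if_true, zero_mul, mul_zero, Finset.sum_const_zero, zero_add, add_zero, one_mul]
  simp only [← Finset.sum_add_distrib]
  refine Finset.sum_congr rfl fun q _ => Finset.sum_congr rfl fun r _ => ?_
  ring

/-! ### Appended (same generation): the budget `e(B∩C)` of the OR8 two-payer vector by cells -/

/-- **The OR8 two-payer budget by outer cells**: for the vector `e` of the two-payer OR star (`4·2^k + 3h_V` on the four T-cells, `4·2^k·1_V` on the
cell `00`, `(2·2^k + 2d)·1_V` on the four other cells — the vector OR8(4·1_T; V, d), memo §1), `Σ_{x ∈ B∩C} e(x)` is the nine-term point sum over the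
sections.  All finsets `B, C, V`, any `d`. [this work] -/
theorem budget_twoPayer_sections (V : Finset (Pd k)) (d : Pd k → ℤ) (B C : Finset (Pd (1 + (1 + k)))) :
    (∑ x ∈ B ∩ C, (fun x : Pd (1 + (1 + k)) =>
        if (1 ≤ freeOf x 0 ∧ 1 ≤ freeOf (cellOf x) 0) then (4 * 2 ^ k + 3 * (2 ^ k * ind V (cellOf (cellOf x)) - (nuCount V (cellOf (cellOf x)) : ℤ)))
        else if (freeOf x 0 = 0 ∧ freeOf (cellOf x) 0 = 0) then 4 * 2 ^ k * ind V (cellOf (cellOf x))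
        else (2 * 2 ^ k + 2 * d (cellOf (cellOf x))) * ind V (cellOf (cellOf x))) x)
    = ∑ q : Pd k, ( ind B (glue (fun _ => 0) (glue (fun _ => 0) q)) * ind C (glue (fun _ => 0) (glue (fun _ => 0) q)) * (4 * 2 ^ k * ind V q)
        + ind B (glue (fun _ => 0) (glue (fun _ => 1) q)) * ind C (glue (fun _ => 0) (glue (fun _ => 1) q)) * ((2 * 2 ^ k + 2 * d q) * ind V q)
        + ind B (glue (fun _ => 0) (glue (fun _ => 2) q)) * ind C (glue (fun _ => 0) (glue (fun _ => 2) q)) * ((2 * 2 ^ k + 2 * d q) * ind V q)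
        + ind B (glue (fun _ => 1) (glue (fun _ => 0) q)) * ind C (glue (fun _ => 1) (glue (fun _ => 0) q)) * ((2 * 2 ^ k + 2 * d q) * ind V q)
        + ind B (glue (fun _ => 1) (glue (fun _ => 1) q)) * ind C (glue (fun _ => 1) (glue (fun _ => 1) q)) * (4 * 2 ^ k + 3 * (2 ^ k * ind V q - (nuCount V q : ℤ)))
        + ind B (glue (fun _ => 1) (glue (fun _ => 2) q)) * ind C (glue (fun _ => 1) (glue (fun _ => 2) q)) * (4 * 2 ^ k + 3 * (2 ^ k * ind V q - (nuCount V q : ℤ)))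
        + ind B (glue (fun _ => 2) (glue (fun _ => 0) q)) * ind C (glue (fun _ => 2) (glue (fun _ => 0) q)) * ((2 * 2 ^ k + 2 * d q) * ind V q)
        + ind B (glue (fun _ => 2) (glue (fun _ => 1) q)) * ind C (glue (fun _ => 2) (glue (fun _ => 1) q)) * (4 * 2 ^ k + 3 * (2 ^ k * ind V q - (nuCount V q : ℤ)))
        + ind B (glue (fun _ => 2) (glue (fun _ => 2) q)) * ind C (glue (fun _ => 2) (glue (fun _ => 2) q)) * (4 * 2 ^ k + 3 * (2 ^ k * ind V q - (nuCount V q : ℤ))) ) := by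
  have f11 : (1:Fin 3) ≤ 1 := le_rfl
  have f12 : (1:Fin 3) ≤ 2 := by decide
  have f10 : ¬ (1:Fin 3) ≤ 0 := by decide
  have e10 : ¬ ((1:Fin 3) = 0) := by decide
  have e20 : ¬ ((2:Fin 3) = 0) := by decide
  rw [sum_mem_eq_sum_ind_mul (B ∩ C), sum_glue (n := 1) (k := 1 + k)]
  simp only [ind_inter_eq_mul, sum_glue (n := 1) (k := k), sum_pd1, freeOf_glue, cellOf_glue, f11, f12, f10, e10, e20,
    and_true, and_false, if_true, if_false, Finset.sum_add_distrib]
  simp only [← Finset.sum_add_distrib]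
  refine Finset.sum_congr rfl fun q _ => ?_
  ring


end Summit.CriticalPhenomena.PercolationContinuityZ3.Theorems.SahiGridPattern
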